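import Summits.CriticalPhenomena.Ising3D.Control2DParityConverse
import Mathlib.Analysis.SpecialFunctions.Pow.Real
import Mathlib.Tactic.Linarith
import Mathlib.Tactic.Positivity
import Mathlib.Tactic.FieldSimp
import Mathlib.Tactic.Ring
import Mathlib.Tactic.NormNum
import HarnessLib

/-!
# A-priori two-sided envelope for the four-point function of every datum in the typed class
(cell `pub-ising3x`, seat controls-1 gen 42; PAPER §6.2 / Appendix E — CONTROL-ONLY; companion of `Control2DFourPoint`)

HONEST FRAMING: lottery ticket; floor = tightest certified 3D Ising CFT bounds; no exact-solution
claim without a proof. CONTROL-ONLY (`d = 2`, `Δ_σ = s` an INPUT, axiom set `A2D′`); nothing here is about `d = 3`,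
no certificate, functional or number of the record is touched, and no new hypothesis or named fact enters.

`Control2DFourPoint` shows that a unitary solution of the typed sum rule with all labels `Δ_i ≥ τ₀ > 2s` is a convergent,
crossing-symmetric four-point function `G(z,z̄) = 1 + Σ p_i g_i(z,z̄)` on the open square. This file adds the
ELEMENTARY A-PRIORI ENVELOPE that the same two facts put around `G`, in closed form and with no certificate:

* `fourPoint_mono` — `G` is increasing in each variable (every term is, `globalBlock_mono`);
* **`fourPoint_lower`** — crossing symmetry and `G ≥ 1` at the reflected point give `u^s ≤ v^s G(z,z̄)` on the whole
  square, i.e. `G(z,z̄) ≥ (u/v)^s` (the identity operator in the crossed channel; no gap needed beyond convergence);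
* **`fourPoint_diag_upper`** — on the diagonal `y = 1 - x ∈ (1/2, 1)` the sign argument of gen 14
  (`crossF_globalBlock_diag_le`: every sum-rule term at the mirror point `x < 1/2` is `≤ -c · p_i g_i(y,y)`,
  `c = diagConst s τ₀ x > 0`) sums to `c · (G(y,y) - 1) ≤ F_-[1](x,x)`, i.e.
  `G(y,y) ≤ 1 + F_-[1](x,x)/c`; in closed form (`crossF_one_div_diagConst`)
  **`G(y,y) ≤ 1 + (1 - ρ^{2s})/(ρ^{2s} - ρ^{τ₀})`, `ρ = x/(1-x) = (1-y)/y ∈ (0,1)`** — so together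
  `(1/ρ)^{2s} ≤ G(y,y) ≤ 1 + (1 - ρ^{2s})/(ρ^{2s} - ρ^{τ₀})`, an envelope whose two sides have ratio `→ 1` as
  `y → 1`; off the diagonal `G(z,z̄) ≤ G(y,y)` for `y ≥ max(z,z̄)` (`fourPoint_le_diag_upper`);
* the record's class at `Δ_σ = 1/8` (`record_fourPoint_envelope (w)`: scalars `{x} ∪ [2,∞)`, spin 2 `{2} ∪ [3,∞)`,
  `w ≤ x`; the record gives `x > 0.99`, so `τ₀ = 99/100`): for every `y ∈ (1/2,1)`,
  `(y/(1-y))^{1/4} ≤ G(y,y) ≤ 1 + (1 - ρ^{1/4})/(ρ^{1/4} - ρ^{99/100})`; a decimal-free instance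
  **`record_fourPoint_at_sixteen_seventeenths (w)`: `2 ≤ G(16/17, 16/17) ≤ 7/3`** (upper side with the weaker
  `τ₀ = 3/4`, where `ρ = 1/16` gives `ρ^{1/4} = 1/2`, `ρ^{3/4} = 1/8`). For orientation only (FLOAT, not used):
  the 2D Ising correlator has `G(y,y) = (1-y)^{-1/4}`, `= 17^{1/4} ≈ 2.03` at `y = 16/17`, inside `[2, 7/3]`.

NOT claimed: sharpness (the optimal bounds on correlator values are a linear-programming problem — M. F. Paulos,
arXiv:2012.10454; M. F. Paulos, B. Zan, arXiv:2107.01215 — not attempted here); anything at `y ≤ 1/2` beyond `G ≥ 1` and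
the crossing lower bound; anything off the real open square; that `fourPoint` is a CFT correlator; Virasoro; 3D; any new
bound on `Δ_ε`, `c` or `λ²`; no certificate / functional / number of the record is touched.

References: R. Rattazzi, V. S. Rychkov, E. Tonni, A. Vichi, JHEP 12 (2008) 031, §3 eq. (3.3)–(3.6) [cite: RattazziEtAl2008, §3];
D. Pappadopulo, S. Rychkov, J. Espin, R. Rattazzi, Phys. Rev. D 86 (2012) 105043, §4 (tail estimates from the same
positivity). Tree: `fourPoint`, `fourPoint_crossing`, `one_le_fourPoint`, `globalBlock_mono`, `opeConvergent_of_lowerBound`,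
`lowerBound_of_location` (`Control2DFourPoint`); `diagConst`, `diagConst_pos`, `crossF_globalBlock_diag_le`
(`Control2DBlockShape`); `twoSided_2d_kernel099` (`Control2DRecord` closure). Mathlib: `hasSum_le`, `Real.rpow_*`.
-/

namespace Summit.CriticalPhenomena.Ising3D.Control2D

open Set
open Literature.MathematicalPhysics.QuantumFieldTheory.ConformalBootstrap3D

/-! ### Closed forms on the diagonal -/

/-- `F^{s}_-[1](x,x) = ((1-x)²)^s - (x²)^s`. [folklore] -/
theorem crossF_one_diag (s x : ℝ) :
    crossF s (-1) (fun _ _ => (1 : ℝ)) x x = ((1 - x) * (1 - x)) ^ s - (x * x) ^ s := by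
  simp only [crossF]; ring

/-- `(x²)^s = ((1-x)²)^s · ρ^{2s}` with `ρ = x/(1-x)`, for `0 < x < 1`. [folklore] -/
theorem rpow_sq_eq_mirror_mul (s : ℝ) {x : ℝ} (hx0 : 0 < x) (hx1 : x < 1) :
    (x * x) ^ s = ((1 - x) * (1 - x)) ^ s * (x / (1 - x)) ^ (2 * s) := by
  have h1x0 : 0 < 1 - x := by linarith
  have hv0 : 0 ≤ (1 - x) * (1 - x) := (mul_pos h1x0 h1x0).le
  have hb0 : 0 ≤ x / (1 - x) := (div_pos hx0 h1x0).le
  rw [Real.rpow_mul hb0, Real.rpow_two, ← Real.mul_rpow hv0 (sq_nonneg _)]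
  congr 1
  field_simp

/-- **The diagonal ratio in closed form**: for `0 < x < 1/2` and `τ₀ > 2s`,
`F_-[1](x,x) / diagConst(s,τ₀,x) = (1 - ρ^{2s}) / (ρ^{2s} - ρ^{τ₀})`, `ρ = x/(1-x) ∈ (0,1)`. [folklore] -/
theorem crossF_one_div_diagConst {s τ₀ x : ℝ} (hτ₀ : 2 * s < τ₀) (hx0 : 0 < x) (hx2 : x < 1 / 2) :
    crossF s (-1) (fun _ _ => (1 : ℝ)) x x / diagConst s τ₀ x =
      (1 - (x / (1 - x)) ^ (2 * s)) / ((x / (1 - x)) ^ (2 * s) - (x / (1 - x)) ^ τ₀) := by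
  have h1x0 : 0 < 1 - x := by linarith
  have hV : 0 < ((1 - x) * (1 - x)) ^ s := Real.rpow_pos_of_pos (mul_pos h1x0 h1x0) s
  have hb0 : 0 < x / (1 - x) := div_pos hx0 h1x0
  have hb1 : x / (1 - x) < 1 := by rw [div_lt_one h1x0]; linarith
  have hden : 0 < (x / (1 - x)) ^ (2 * s) - (x / (1 - x)) ^ τ₀ := by
    have := Real.rpow_lt_rpow_of_exponent_gt hb0 hb1 hτ₀
    linarith
  rw [crossF_one_diag, rpow_sq_eq_mirror_mul s hx0 (by linarith), diagConst]
  rw [show ((1 - x) * (1 - x)) ^ s - ((1 - x) * (1 - x)) ^ s * (x / (1 - x)) ^ (2 * s) =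
      ((1 - x) * (1 - x)) ^ s * (1 - (x / (1 - x)) ^ (2 * s)) by ring]
  rw [mul_div_mul_left _ _ hV.ne']

namespace CrossingData

variable {D : CrossingData} {s : ℝ}

/-! ### Monotonicity and the crossing lower bound -/

/-- **`G` is increasing in each variable** on the square (unitary data with convergent expansion). [folklore] -/
theorem fourPoint_mono (hU : D.IsUnitary) (hconv : D.OpeConvergent) {z zb z' zb' : ℝ} (hz : 0 < z)
    (hzb : 0 < zb) (hzz' : z ≤ z') (hzbzb' : zb ≤ zb') (hz' : z' < 1) (hzb' : zb' < 1) :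
    D.fourPoint z zb ≤ D.fourPoint z' zb' := by
  have h1 : z ∈ Ioo (0 : ℝ) 1 := ⟨hz, lt_of_le_of_lt hzz' hz'⟩
  have h2 : zb ∈ Ioo (0 : ℝ) 1 := ⟨hzb, lt_of_le_of_lt hzbzb' hzb'⟩
  have h1' : z' ∈ Ioo (0 : ℝ) 1 := ⟨lt_of_lt_of_le hz hzz', hz'⟩
  have h2' : zb' ∈ Ioo (0 : ℝ) 1 := ⟨lt_of_lt_of_le hzb hzbzb', hzb'⟩
  have h := hasSum_le (fun i => mul_le_mul_of_nonneg_left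
    (globalBlock_mono (hU i).2.1 hz hzb hzz' hzbzb' hz' hzb') (hU i).2.2)
    (hconv z zb h1 h2).hasSum (hconv z' zb' h1' h2').hasSum
  unfold fourPoint
  linarith

/-- **The crossing lower bound**: `u^s ≤ v^s G(z,z̄)` at every point of the open square, for every unitary solution of
the typed sum rule with convergent expansion — crossing symmetry `v^s G(z,z̄) = u^s G(1-z,1-z̄)` and `G(1-z,1-z̄) ≥ 1`
(the identity operator in the crossed channel). [cite: RattazziEtAl2008, §3 eq. (3.3)] -/
theorem fourPoint_lower (hU : D.IsUnitary) (hC : D.SatisfiesCrossing s) (hconv : D.OpeConvergent) {z zb : ℝ}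
    (hz : z ∈ Ioo (0 : ℝ) 1) (hzb : zb ∈ Ioo (0 : ℝ) 1) :
    (z * zb) ^ s ≤ ((1 - z) * (1 - zb)) ^ s * D.fourPoint z zb := by
  have hz' : 1 - z ∈ Ioo (0 : ℝ) 1 := ⟨by linarith [hz.2], by linarith [hz.1]⟩
  have hzb' : 1 - zb ∈ Ioo (0 : ℝ) 1 := ⟨by linarith [hzb.2], by linarith [hzb.1]⟩
  have hX := fourPoint_crossing hC hconv hz hzb
  have hG := one_le_fourPoint hU hz' hzb'
  have hu : 0 ≤ (z * zb) ^ s := Real.rpow_nonneg (mul_pos hz.1 hzb.1).le s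
  calc (z * zb) ^ s = (z * zb) ^ s * 1 := by ring
    _ ≤ (z * zb) ^ s * D.fourPoint (1 - z) (1 - zb) := mul_le_mul_of_nonneg_left hG hu
    _ = ((1 - z) * (1 - zb)) ^ s * D.fourPoint z zb := hX.symm

/-- The crossing lower bound in ratio form: `G(z,z̄) ≥ u^s / v^s = (z z̄ / ((1-z)(1-z̄)))^s`. [cite: RattazziEtAl2008, §3] -/
theorem fourPoint_lower_div (hU : D.IsUnitary) (hC : D.SatisfiesCrossing s) (hconv : D.OpeConvergent) {z zb : ℝ}
    (hz : z ∈ Ioo (0 : ℝ) 1) (hzb : zb ∈ Ioo (0 : ℝ) 1) :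
    (z * zb) ^ s / ((1 - z) * (1 - zb)) ^ s ≤ D.fourPoint z zb := by
  have hv : 0 < ((1 - z) * (1 - zb)) ^ s :=
    Real.rpow_pos_of_pos (mul_pos (by linarith [hz.2]) (by linarith [hzb.2])) s
  rw [div_le_iff₀ hv]
  have h := fourPoint_lower hU hC hconv hz hzb
  linarith

/-! ### The gap upper bound on the diagonal -/

/-- **The sign argument, summed**: for unitary data solving the typed sum rule with all labels `Δ_i ≥ τ₀ > 2s`, at a
mirror point `0 < x < 1/2`: `diagConst(s,τ₀,x) · (G(1-x,1-x) - 1) ≤ F_-[1](x,x)` (every term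
`p_i F_-[g_i](x,x) ≤ -c · p_i g_i(1-x,1-x)`, `crossF_globalBlock_diag_le`, and the terms sum to `-F_-[1](x,x)`).
[cite: RattazziEtAl2008, §3] -/
theorem diagConst_mul_fourPoint_le (hU : D.IsUnitary) (hC : D.SatisfiesCrossing s) {τ₀ : ℝ}
    (hτ : ∀ i, τ₀ ≤ D.Δ i) (hτ₀ : 2 * s < τ₀) {x : ℝ} (hx0 : 0 < x) (hx2 : x < 1 / 2) :
    diagConst s τ₀ x * (D.fourPoint (1 - x) (1 - x) - 1) ≤ crossF s (-1) (fun _ _ => (1 : ℝ)) x x := by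
  have hconv := opeConvergent_of_lowerBound hU hC hτ hτ₀
  have hx : x ∈ Ioo (0 : ℝ) 1 := ⟨hx0, by linarith⟩
  have h1x : 1 - x ∈ Ioo (0 : ℝ) 1 := ⟨by linarith, by linarith⟩
  have A := hC x x hx hx
  have hG : D.fourPoint (1 - x) (1 - x) - 1 = ∑' i, D.p i * globalBlock (D.Δ i) (D.spin i) (1 - x) (1 - x) := by
    unfold fourPoint; ring
  have B : HasSum (fun i => -(diagConst s τ₀ x) * (D.p i * globalBlock (D.Δ i) (D.spin i) (1 - x) (1 - x)))
      (-(diagConst s τ₀ x) * (D.fourPoint (1 - x) (1 - x) - 1)) := by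
    rw [hG]
    exact (hconv (1 - x) (1 - x) h1x h1x).hasSum.mul_left _
  have hle : ∀ i, D.p i * crossF s (-1) (globalBlock (D.Δ i) (D.spin i)) x x ≤
      -(diagConst s τ₀ x) * (D.p i * globalBlock (D.Δ i) (D.spin i) (1 - x) (1 - x)) := by
    intro i
    have h := mul_le_mul_of_nonneg_left
      (crossF_globalBlock_diag_le (s := s) (hU i).2.1 (hτ i) hx0 hx2.le) (hU i).2.2
    have e : D.p i * (-(diagConst s τ₀ x) * globalBlock (D.Δ i) (D.spin i) (1 - x) (1 - x)) =
        -(diagConst s τ₀ x) * (D.p i * globalBlock (D.Δ i) (D.spin i) (1 - x) (1 - x)) := by ring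
    linarith
  have := hasSum_le hle A B
  linarith

/-- **The gap upper bound on the diagonal**: `G(1-x,1-x) ≤ 1 + F_-[1](x,x) / diagConst(s,τ₀,x)` for `0 < x < 1/2`,
all labels `≥ τ₀ > 2s`. [cite: RattazziEtAl2008, §3] -/
theorem fourPoint_diag_upper (hU : D.IsUnitary) (hC : D.SatisfiesCrossing s) {τ₀ : ℝ} (hτ : ∀ i, τ₀ ≤ D.Δ i)
    (hτ₀ : 2 * s < τ₀) {x : ℝ} (hx0 : 0 < x) (hx2 : x < 1 / 2) :
    D.fourPoint (1 - x) (1 - x) ≤ 1 + crossF s (-1) (fun _ _ => (1 : ℝ)) x x / diagConst s τ₀ x := by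
  have hc := diagConst_pos hτ₀ hx0 hx2
  have h := diagConst_mul_fourPoint_le hU hC hτ hτ₀ hx0 hx2
  have : D.fourPoint (1 - x) (1 - x) - 1 ≤ crossF s (-1) (fun _ _ => (1 : ℝ)) x x / diagConst s τ₀ x := by
    rw [le_div_iff₀ hc, mul_comm]; exact h
  linarith

/-- **The envelope on the diagonal, closed form**: for `y ∈ (1/2, 1)`, `ρ = (1-y)/y`, every unitary solution with all
labels `≥ τ₀ > 2s` has `G(y,y) ≤ 1 + (1 - ρ^{2s})/(ρ^{2s} - ρ^{τ₀})` (and `G(y,y) ≥ (1/ρ)^{2s}` by `fourPoint_lower`).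
[cite: RattazziEtAl2008, §3] -/
theorem fourPoint_diag_upper_closed (hU : D.IsUnitary) (hC : D.SatisfiesCrossing s) {τ₀ : ℝ}
    (hτ : ∀ i, τ₀ ≤ D.Δ i) (hτ₀ : 2 * s < τ₀) {y : ℝ} (hy2 : 1 / 2 < y) (hy1 : y < 1) :
    D.fourPoint y y ≤ 1 + (1 - ((1 - y) / y) ^ (2 * s)) / (((1 - y) / y) ^ (2 * s) - ((1 - y) / y) ^ τ₀) := by
  have hx0 : 0 < 1 - y := by linarith
  have hx2 : 1 - y < 1 / 2 := by linarith
  have h := fourPoint_diag_upper hU hC hτ hτ₀ hx0 hx2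
  rw [crossF_one_div_diagConst hτ₀ hx0 hx2] at h
  simp only [sub_sub_cancel] at h
  exact h

/-- **Off the diagonal**: `G(z,z̄) ≤ G(y,y) ≤ 1 + F_-[1](1-y,1-y)/diagConst(s,τ₀,1-y)` for any `y ∈ (1/2,1)` with
`z, z̄ ≤ y` (monotonicity + the diagonal bound). [cite: RattazziEtAl2008, §3] -/
theorem fourPoint_le_diag_upper (hU : D.IsUnitary) (hC : D.SatisfiesCrossing s) {τ₀ : ℝ} (hτ : ∀ i, τ₀ ≤ D.Δ i)
    (hτ₀ : 2 * s < τ₀) {z zb y : ℝ} (hz : 0 < z) (hzb : 0 < zb) (hzy : z ≤ y) (hzby : zb ≤ y) (hy2 : 1 / 2 < y)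
    (hy1 : y < 1) :
    D.fourPoint z zb ≤ 1 + crossF s (-1) (fun _ _ => (1 : ℝ)) (1 - y) (1 - y) / diagConst s τ₀ (1 - y) := by
  have hconv := opeConvergent_of_lowerBound hU hC hτ hτ₀
  have h1 := fourPoint_mono hU hconv hz hzb hzy hzby hy1 hy1
  have h2 := fourPoint_diag_upper hU hC hτ hτ₀ (x := 1 - y) (by linarith) (by linarith)
  simp only [sub_sub_cancel] at h2
  linarith

end CrossingData

/-! ### The record's class at `Δ_σ = 1/8` -/

/-- **A-priori envelope for every datum of the record's class.** At `Δ_σ = 1/8`, for every window `w`: a unitary solution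
with spin 2 in `{2} ∪ [3,∞)` and scalars in `{x} ∪ [2,∞)`, `w ≤ x`, has `x > 0.99` by the record
(`twoSided_2d_kernel099`), hence all labels `≥ 99/100 > 1/4`, hence for every `y ∈ (1/2,1)`:
`(y²)^{1/8}/((1-y)²)^{1/8} ≤ G(y,y) ≤ 1 + F_-[1](1-y,1-y)/diagConst(1/8, 99/100, 1-y)` — in closed form
`(y/(1-y))^{1/4} ≤ G(y,y) ≤ 1 + (1-ρ^{1/4})/(ρ^{1/4}-ρ^{0.99})`, `ρ = (1-y)/y`. CONTROL-ONLY; no certificate.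
[cite: RattazziEtAl2008, §3] -/
theorem record_fourPoint_envelope (w : ℝ) (D : CrossingData) (hU : D.IsUnitary)
    (hC : D.SatisfiesCrossing (1 / 8)) (hT : D.SpinTwoIn ({2} ∪ Ici (2 + 1))) (x : ℝ) (hwx : w ≤ x)
    (hS : D.ScalarsIn ({x} ∪ Ici 2)) {y : ℝ} (hy2 : 1 / 2 < y) (hy1 : y < 1) :
    (y * y) ^ (1 / 8 : ℝ) / ((1 - y) * (1 - y)) ^ (1 / 8 : ℝ) ≤ D.fourPoint y y ∧
      D.fourPoint y y ≤ 1 + crossF (1 / 8) (-1) (fun _ _ => (1 : ℝ)) (1 - y) (1 - y) /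
        diagConst (1 / 8) (99 / 100) (1 - y) := by
  have hx : (99 / 100 : ℝ) < x := ((twoSided_2d_kernel099 w) D hU hC hT x hwx hS).1
  have hτ : ∀ i, (99 / 100 : ℝ) ≤ D.Δ i := fun i =>
    le_trans (le_min (le_min hx.le (by norm_num)) (by norm_num)) (CrossingData.lowerBound_of_location hU hS i)
  have hτ₀ : 2 * (1 / 8 : ℝ) < 99 / 100 := by norm_num
  have hy : y ∈ Ioo (0 : ℝ) 1 := ⟨by linarith, hy1⟩
  have hconv := CrossingData.opeConvergent_of_lowerBound hU hC hτ hτ₀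
  refine ⟨CrossingData.fourPoint_lower_div hU hC hconv hy hy, ?_⟩
  have h2 := CrossingData.fourPoint_diag_upper hU hC hτ hτ₀ (x := 1 - y) (by linarith) (by linarith)
  simp only [sub_sub_cancel] at h2
  exact h2

/-- `256^{1/8} = 2`. [folklore] -/
theorem rpow_256_eighth : (256 : ℝ) ^ (1 / 8 : ℝ) = 2 := by
  rw [show (256 : ℝ) = 2 ^ (8 : ℕ) by norm_num, show (1 / 8 : ℝ) = ((8 : ℕ) : ℝ)⁻¹ by norm_num]
  exact Real.pow_rpow_inv_natCast (by norm_num) (by norm_num)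

/-- `(1/16)^{2·(1/8)} = 1/2`. [folklore] -/
theorem rpow_sixteenth_quarter : (1 / 16 : ℝ) ^ (2 * (1 / 8 : ℝ)) = 1 / 2 := by
  rw [show (1 / 16 : ℝ) = (1 / 2) ^ (4 : ℕ) by norm_num, show (2 * (1 / 8 : ℝ)) = ((4 : ℕ) : ℝ)⁻¹ by norm_num]
  exact Real.pow_rpow_inv_natCast (by norm_num) (by norm_num)

/-- `(1/16)^{3/4} = 1/8`. [folklore] -/
theorem rpow_sixteenth_three_quarters : (1 / 16 : ℝ) ^ (3 / 4 : ℝ) = 1 / 8 := by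
  rw [show (1 / 16 : ℝ) = (1 / 2) ^ (4 : ℕ) by norm_num, ← Real.rpow_natCast (1 / 2 : ℝ) 4,
    ← Real.rpow_mul (by norm_num : (0 : ℝ) ≤ 1 / 2)]
  rw [show ((4 : ℕ) : ℝ) * (3 / 4 : ℝ) = ((3 : ℕ) : ℝ) by norm_num, Real.rpow_natCast]
  norm_num

/-- **A decimal-free instance: `2 ≤ G(16/17, 16/17) ≤ 7/3` for every datum of the record's class at `Δ_σ = 1/8`.**
Lower side: `(u/v)^{1/8} = 256^{1/8} = 2`. Upper side with the weaker admissible bound `τ₀ = 3/4` (`≤ 0.99 < x`): at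
`y = 16/17`, `ρ = 1/16`, `ρ^{1/4} = 1/2`, `ρ^{3/4} = 1/8`, so `1 + (1 - 1/2)/(1/2 - 1/8) = 7/3`. (FLOAT, orientation only,
not used: the 2D Ising value is `17^{1/4} ≈ 2.03`; the `τ₀ = 0.99` bound is `≈ 2.147`.) CONTROL-ONLY.
[cite: RattazziEtAl2008, §3] -/
theorem record_fourPoint_at_sixteen_seventeenths (w : ℝ) (D : CrossingData) (hU : D.IsUnitary)
    (hC : D.SatisfiesCrossing (1 / 8)) (hT : D.SpinTwoIn ({2} ∪ Ici (2 + 1))) (x : ℝ) (hwx : w ≤ x)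
    (hS : D.ScalarsIn ({x} ∪ Ici 2)) :
    2 ≤ D.fourPoint (16 / 17) (16 / 17) ∧ D.fourPoint (16 / 17) (16 / 17) ≤ 7 / 3 := by
  have hx : (99 / 100 : ℝ) < x := ((twoSided_2d_kernel099 w) D hU hC hT x hwx hS).1
  have hτ : ∀ i, (3 / 4 : ℝ) ≤ D.Δ i := fun i =>
    le_trans (le_min (le_min (by linarith) (by norm_num)) (by norm_num)) (CrossingData.lowerBound_of_location hU hS i)
  have hτ₀ : 2 * (1 / 8 : ℝ) < 3 / 4 := by norm_num
  have hy : (16 / 17 : ℝ) ∈ Ioo (0 : ℝ) 1 := ⟨by norm_num, by norm_num⟩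
  have hconv := CrossingData.opeConvergent_of_lowerBound hU hC hτ hτ₀
  constructor
  · have h := CrossingData.fourPoint_lower_div hU hC hconv hy hy
    have hval : ((16 / 17 : ℝ) * (16 / 17)) ^ (1 / 8 : ℝ) / ((1 - 16 / 17) * (1 - 16 / 17)) ^ (1 / 8 : ℝ) = 2 := by
      rw [← Real.div_rpow (by norm_num) (by norm_num)]
      rw [show ((16 / 17 : ℝ) * (16 / 17)) / ((1 - 16 / 17) * (1 - 16 / 17)) = 256 by norm_num]
      exact rpow_256_eighth
    rw [hval] at h
    exact h
  · have h := CrossingData.fourPoint_diag_upper_closed hU hC hτ hτ₀ (y := 16 / 17) (by norm_num) (by norm_num)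
    rw [show ((1 - 16 / 17) / (16 / 17) : ℝ) = 1 / 16 by norm_num, rpow_sixteenth_quarter,
      rpow_sixteenth_three_quarters] at h
    norm_num at h
    linarith

end Summit.CriticalPhenomena.Ising3D.Control2D
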